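import Literature.MathematicalPhysics.QuantumLattice.SectorPropagatorDecay
import Literature.Analysis.Fourier.FourierLinearChange
import Mathlib.Analysis.SpecialFunctions.JapaneseBracket
import HarnessLib

/-!
# The `L¹` bound of the single-scale sector propagators (BGM 2006, (2.81))

Topic `Literature/MathematicalPhysics/QuantumLattice`; a corollary of `SectorPropagatorDecay`
(Lemma 2.2 (2.52): `|g^{(h)}_ω(x)| ≤ C_N γ^{(3/2)h}(1 + |(γ^h x₀, γ^h x'₁, γ^{h/2} x'₂)|/(2π))^{-N}`).
Integrating the decay bound with `N = 4` over `x = (x₀, x⃗) ∈ ℝ × ℝ²` and undoing the anisotropic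
rescaling (a linear change of variables of Jacobian `(2π)³ γ^{-h} γ^{-h} γ^{-h/2}`) gives the
single-line version of BGM's (2.81):

* `continuous_sectorPropagator` — `g^{(h)}_ω` is continuous (a Fourier transform of an `L¹` symbol);
* **`sectorPropagator_l1`** — there is `C` with `∫ |g^{(h)}_ω(x)| dx ≤ C γ^{-h} = C 4ⁿ` for all
  `n` and all sectors `0 ≤ ω < 2^{n+1}` (and `g^{(h)}_ω ∈ L¹`).

Everything is PROVED; the one definition is the rescaling map `sectorDualLin` (a linear
automorphism of `ℝ³`).

## Sources

* G. Benfatto, A. Giuliani, V. Mastropietro, Ann. Henri Poincaré 7 (2006) 809–898, §2.6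
  (2.81) (arXiv:cond-mat/0507686 p. 15), from Lemma 2.2. [BenfattoGiulianiMastropietro2006]
* G. Benfatto, A. Giuliani, V. Mastropietro, Ann. Henri Poincaré 4 (2003) 137–193, §3 (3.33).
  [BenfattoGiulianiMastropietro2003]
-/

noncomputable section

open Real Set Complex Function Metric MeasureTheory MeasureTheory.Measure Module
open scoped Topology FourierTransform
open Literature.Analysis.Fourier

namespace Literature.MathematicalPhysics.QuantumLattice

/-! ### The rescaling map `(x₀, x⃗) ↦ (γ^h x₀, γ^h x'₁, γ^{h/2} x'₂)/(2π)` as a linear automorphism -/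

/-- The matrix of `q ↦ sectorChartAdj μ θ₀ n (dualPoint q₀ (q₁, q₂))`. [folklore] -/
def sectorDualMatrix (μ θ₀ : ℝ) (n : ℕ) : Matrix (Fin 3) (Fin 3) ℝ :=
  !![(4 : ℝ) ^ (-(n : ℤ)) / (2 * π), 0, 0;
     0, -((4 : ℝ) ^ (-(n : ℤ)) * fermiNormal μ θ₀ 0) / (2 * π), -((4 : ℝ) ^ (-(n : ℤ)) * fermiNormal μ θ₀ 1) / (2 * π);
     0, -((2 : ℝ) ^ (-(n : ℤ)) * fermiTangent μ θ₀ 0) / (2 * π), -((2 : ℝ) ^ (-(n : ℤ)) * fermiTangent μ θ₀ 1) / (2 * π)]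

/-- The rescaling map as a linear endomorphism of `ℝ³`. [folklore] -/
def sectorDualLin (μ θ₀ : ℝ) (n : ℕ) : MomSpace →ₗ[ℝ] MomSpace := Matrix.toEuclideanLin (sectorDualMatrix μ θ₀ n)

/-- `sectorDualLin q = sectorChartAdj (dualPoint q₀ (q₁, q₂))`. [folklore] -/
theorem sectorDualLin_apply (μ θ₀ : ℝ) (n : ℕ) (q : MomSpace) :
    sectorDualLin μ θ₀ n q = sectorChartAdj μ θ₀ n (dualPoint (q 0) ![q 1, q 2]) := by
  rw [sectorDualLin, Matrix.toEuclideanLin, Matrix.toLpLin_apply, sectorChartAdj]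
  congr 1
  funext i
  fin_cases i <;>
    simp [sectorDualMatrix, Matrix.mulVec, dotProduct, Fin.sum_univ_three, dualPoint] <;> ring

section Det

variable {μ : ℝ} (hμ₁ : -4 < μ) (hμ₂ : μ < -2 - Real.sqrt 2)
include hμ₁ hμ₂

/-- Its determinant `(2π)^{-3} 4^{-n} 4^{-n} 2^{-n}` (the frame is oriented orthonormal). [folklore] -/
theorem det_sectorDualLin (θ₀ : ℝ) (n : ℕ) :
    LinearMap.det (sectorDualLin μ θ₀ n) =
      ((4 : ℝ) ^ (-(n : ℤ)) * (4 : ℝ) ^ (-(n : ℤ)) * (2 : ℝ) ^ (-(n : ℤ))) / (2 * π) ^ 3 := by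
  have hframe := det_fermiFrameMatrix hμ₁ hμ₂ θ₀
  rw [fermiFrameMatrix, Matrix.det_fin_two_of] at hframe
  rw [sectorDualLin, Matrix.toEuclideanLin, LinearMap.det_toLpLin, sectorDualMatrix, Matrix.det_fin_three]
  simp only [Matrix.of_apply, Matrix.cons_val', Matrix.cons_val_zero, Matrix.cons_val_one, Matrix.cons_val_two,
    Matrix.empty_val', Matrix.cons_val_fin_one, Matrix.head_cons, Matrix.tail_cons, Matrix.head_fin_const]
  have hπ : (2 * π) ≠ 0 := by positivity
  field_simp
  linear_combination ((4 : ℝ) ^ (-(n : ℤ)) * (4 : ℝ) ^ (-(n : ℤ)) * (2 : ℝ) ^ (-(n : ℤ))) * hframe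

/-- The determinant is positive. [folklore] -/
theorem det_sectorDualLin_pos (θ₀ : ℝ) (n : ℕ) : 0 < LinearMap.det (sectorDualLin μ θ₀ n) := by
  rw [det_sectorDualLin hμ₁ hμ₂]; positivity

/-- The rescaling map as a continuous linear automorphism. [folklore] -/
def sectorDualEquiv (θ₀ : ℝ) (n : ℕ) : MomSpace ≃L[ℝ] MomSpace :=
  (LinearMap.equivOfDetNeZero (sectorDualLin μ θ₀ n) (det_sectorDualLin_pos hμ₁ hμ₂ θ₀ n).ne').toContinuousLinearEquiv

/-- The automorphism acts as the rescaling map. [folklore] -/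
theorem sectorDualEquiv_apply (θ₀ : ℝ) (n : ℕ) (q : MomSpace) :
    sectorDualEquiv hμ₁ hμ₂ θ₀ n q = sectorChartAdj μ θ₀ n (dualPoint (q 0) ![q 1, q 2]) := by
  rw [← sectorDualLin_apply]; rfl

/-- Its determinant. [folklore] -/
theorem det_sectorDualEquiv (θ₀ : ℝ) (n : ℕ) :
    LinearMap.det ((sectorDualEquiv hμ₁ hμ₂ θ₀ n : MomSpace ≃ₗ[ℝ] MomSpace) : MomSpace →ₗ[ℝ] MomSpace) =
      ((4 : ℝ) ^ (-(n : ℤ)) * (4 : ℝ) ^ (-(n : ℤ)) * (2 : ℝ) ^ (-(n : ℤ))) / (2 * π) ^ 3 := by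
  rw [← det_sectorDualLin hμ₁ hμ₂ θ₀ n]; rfl

end Det

/-! ### Continuity -/

section L1

variable {μ : ℝ} (hμ₁ : -4 < μ) (hμ₂ : μ < -2 - Real.sqrt 2)
include hμ₁ hμ₂

/-- The symbol on `ℝ³` is continuous with compact support, hence integrable. [folklore] -/
theorem integrable_sectorSymbolE {e₀ : ℝ} (he : 0 < e₀) (he' : e₀ ≤ (4 + μ) / 2) (n : ℕ) (ω : ℤ) :
    Continuous (sectorSymbolE e₀ μ n ω) ∧ Integrable (sectorSymbolE e₀ μ n ω) := by
  set θ₀ : ℝ := ((ω : ℝ) + 1 / 2) * sectorWidth n with hθ₀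
  set A := sectorChart hμ₁ hμ₂ θ₀ n with hA
  set φ : MomSpace ≃ₜ MomSpace := (Homeomorph.addRight (-fermiBasePoint μ θ₀)).trans A.symm.toHomeomorph with hφ
  have heq : sectorSymbolE e₀ μ n ω = rescaledSectorSymbol hμ₁ hμ₂ e₀ n ω ∘ φ := by
    rw [sectorSymbolE_eq_comp hμ₁ hμ₂]; rfl
  have hR : Continuous (rescaledSectorSymbol hμ₁ hμ₂ e₀ n ω) := (contDiff_rescaledSectorSymbol hμ₁ hμ₂ he he' n ω).continuous
  have hRs : HasCompactSupport (rescaledSectorSymbol hμ₁ hμ₂ e₀ n ω) :=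
    (isCompact_momBox _ _ _).of_isClosed_subset (isClosed_tsupport _) (tsupport_rescaledSectorSymbol_subset hμ₁ hμ₂ he he' n ω)
  have hc : Continuous (sectorSymbolE e₀ μ n ω) := by rw [heq]; exact hR.comp φ.continuous
  exact ⟨hc, by rw [heq]; exact (hR.comp φ.continuous).integrable_of_hasCompactSupport (hRs.comp_homeomorph φ)⟩

omit hμ₁ hμ₂ in
/-- `(x₀, x⃗) ↦ ξ(x₀, x⃗)` is continuous. [folklore] -/
theorem continuous_dualPoint : Continuous fun p : ℝ × (Fin 2 → ℝ) => dualPoint p.1 p.2 := by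
  unfold dualPoint
  refine (PiLp.continuous_toLp 2 _).comp ?_
  refine continuous_pi fun i => ?_
  fin_cases i
  · exact (continuous_fst.div_const _)
  · exact ((continuous_apply 0).comp continuous_snd).neg.div_const _
  · exact ((continuous_apply 1).comp continuous_snd).neg.div_const _

/-- **The sector propagator is continuous in `(x₀, x⃗)`.** [folklore] -/
theorem continuous_sectorPropagator {e₀ : ℝ} (he : 0 < e₀) (he' : e₀ ≤ (4 + μ) / 2) (n : ℕ) (ω : ℤ) :
    Continuous fun p : ℝ × (Fin 2 → ℝ) => sectorPropagator e₀ μ n ω p.1 p.2 := by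
  have hF : Continuous (𝓕 (sectorSymbolE e₀ μ n ω)) :=
    VectorFourier.fourierIntegral_continuous Real.continuous_fourierChar (by exact continuous_inner)
      (integrable_sectorSymbolE hμ₁ hμ₂ he he' n ω).2
  have heq : (fun p : ℝ × (Fin 2 → ℝ) => sectorPropagator e₀ μ n ω p.1 p.2) =
      𝓕 (sectorSymbolE e₀ μ n ω) ∘ fun p : ℝ × (Fin 2 → ℝ) => dualPoint p.1 p.2 := by
    funext p; exact sectorPropagator_eq_fourier e₀ μ n ω p.1 p.2
  rw [heq]
  exact hF.comp continuous_dualPoint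

/-! ### The `L¹` bound -/

omit hμ₁ hμ₂ in
/-- `(1 + |u|)^{-4}` is integrable on `ℝ³`. [folklore] -/
theorem integrable_inv_one_add_norm_pow_four : Integrable fun u : MomSpace => ((1 + ‖u‖) ^ 4)⁻¹ := by
  have h := integrable_one_add_norm (E := MomSpace) (μ := volume) (r := 4) (by rw [finrank_euclideanSpace_fin]; norm_num)
  refine h.congr (ae_of_all _ fun u => ?_)
  simp only
  rw [Real.rpow_neg (by positivity), show (4 : ℝ) = ((4 : ℕ) : ℝ) by norm_num, Real.rpow_natCast]

/-- **The `L¹` bound (2.81) of Benfatto–Giuliani–Mastropietro (2006)**: for `0 < e₀ ≤ (4+μ)/2` there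
is `C` with `g^{(h)}_ω ∈ L¹(ℝ × ℝ²)` and `∫ |g^{(h)}_ω(x₀, x⃗)| dx₀ dx⃗ ≤ C 4ⁿ = C γ^{-h}` for all `n` and
all sectors `0 ≤ ω < 2^{n+1}`. [cite: BenfattoGiulianiMastropietro2006, §2.6 (2.81)] -/
theorem sectorPropagator_l1 {e₀ : ℝ} (he : 0 < e₀) (he' : e₀ ≤ (4 + μ) / 2) :
    ∃ C : ℝ, 0 ≤ C ∧ ∀ (n : ℕ) (ω : ℕ), ω < sectorCount n →
      Integrable (fun p : ℝ × (Fin 2 → ℝ) => sectorPropagator e₀ μ n ω p.1 p.2) ∧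
        ∫ p : ℝ × (Fin 2 → ℝ), ‖sectorPropagator e₀ μ n ω p.1 p.2‖ ≤ C * (4 : ℝ) ^ n := by
  obtain ⟨C₀, hC₀, hdec⟩ := sectorPropagator_decay hμ₁ hμ₂ he he' 4
  set I : ℝ := ∫ u : MomSpace, ((1 + ‖u‖) ^ 4)⁻¹ with hI
  have hI0 : 0 ≤ I := integral_nonneg fun u => by positivity
  refine ⟨C₀ * (2 * π) ^ 3 * I, by positivity, fun n ω hω => ?_⟩
  set θ₀ : ℝ := ((ω : ℝ) + 1 / 2) * sectorWidth n with hθ₀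
  set W := sectorDualEquiv hμ₁ hμ₂ θ₀ n with hW
  set F : MomSpace → ℝ := fun u => ((1 + ‖u‖) ^ 4)⁻¹ with hF
  set g : ℝ × (Fin 2 → ℝ) → ℂ := fun p => sectorPropagator e₀ μ n ω p.1 p.2 with hg
  set c : ℝ := C₀ * ((4 : ℝ) ^ (-(n : ℤ)) * (2 : ℝ) ^ (-(n : ℤ))) with hc
  have hc0 : 0 ≤ c := by positivity
  -- the dominating function `b(p) = c F(W(splitMomentum⁻¹ p))`
  set b : ℝ × (Fin 2 → ℝ) → ℝ := fun p => c * F (sectorChartAdj μ θ₀ n (dualPoint p.1 p.2)) with hb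
  have hgb : ∀ p, ‖g p‖ ≤ b p := fun p => by
    have := hdec n ω hω p.1 p.2
    simpa [hg, hb, hc, hF, hθ₀, mul_assoc, mul_comm, mul_left_comm] using this
  -- `b ∘ splitMomentum = c • (F ∘ W)`
  have hbW : (b ∘ splitMomentum) = fun q => c * F (W q) := by
    funext q
    simp only [Function.comp_apply, hb, splitMomentum_apply, hW, sectorDualEquiv_apply]
  -- integrability of `F ∘ W` and the value of its integral
  have hdetW : LinearMap.det ((W : MomSpace ≃ₗ[ℝ] MomSpace) : MomSpace →ₗ[ℝ] MomSpace) ≠ 0 := by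
    rw [hW, det_sectorDualEquiv hμ₁ hμ₂]; positivity
  have hFW : Integrable (fun q => F (W q)) := by
    have hmap : Measure.map (W : MomSpace → MomSpace) volume =
        ENNReal.ofReal |(LinearMap.det ((W : MomSpace ≃ₗ[ℝ] MomSpace) : MomSpace →ₗ[ℝ] MomSpace))⁻¹| • volume :=
      map_linearMap_addHaar_eq_smul_addHaar volume hdetW
    have h1 : Integrable F (Measure.map (W : MomSpace → MomSpace) volume) := by
      rw [hmap]; exact integrable_inv_one_add_norm_pow_four.smul_measure ENNReal.ofReal_ne_top
    exact (integrable_map_equiv W.toHomeomorph.toMeasurableEquiv F).1 h1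
  have hintFW : ∫ q, F (W q) = (2 * π) ^ 3 * ((4 : ℝ) ^ n * (4 : ℝ) ^ n * (2 : ℝ) ^ n) * I := by
    rw [integral_comp_continuousLinearEquiv volume W F, det_sectorDualEquiv hμ₁ hμ₂, smul_eq_mul, ← hI]
    congr 1
    rw [abs_of_pos (by positivity), inv_div, zpow_neg, zpow_neg, zpow_natCast, zpow_natCast]
    field_simp
  -- integrability and integral of `b`
  have hbi : Integrable b := by
    rw [← measurePreserving_splitMomentum.integrable_comp_emb splitMomentum.measurableEmbedding, hbW]
    exact hFW.const_mul c
  have hbint : ∫ p, b p = C₀ * (2 * π) ^ 3 * I * (4 : ℝ) ^ n := by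
    rw [← measurePreserving_splitMomentum.integral_comp splitMomentum.measurableEmbedding]
    change ∫ q, (b ∘ splitMomentum) q = _
    rw [hbW, integral_const_mul, hintFW, hc]
    have h4 : (4 : ℝ) ^ (-(n : ℤ)) * (4 : ℝ) ^ n = 1 := by rw [zpow_neg, zpow_natCast, inv_mul_cancel₀ (by positivity)]
    have h2 : (2 : ℝ) ^ (-(n : ℤ)) * (2 : ℝ) ^ n = 1 := by rw [zpow_neg, zpow_natCast, inv_mul_cancel₀ (by positivity)]
    linear_combination (C₀ * (2 * π) ^ 3 * I * (4 : ℝ) ^ n * ((2 : ℝ) ^ (-(n : ℤ)) * (2 : ℝ) ^ n) ) * h4 +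
      (C₀ * (2 * π) ^ 3 * I * (4 : ℝ) ^ n) * h2
  -- conclude
  have hgm : AEStronglyMeasurable g volume := (continuous_sectorPropagator hμ₁ hμ₂ he he' n ω).aestronglyMeasurable
  have hgi : Integrable g := Integrable.mono' hbi hgm (ae_of_all _ hgb)
  refine ⟨hgi, ?_⟩
  calc ∫ p, ‖g p‖ ≤ ∫ p, b p := integral_mono hgi.norm hbi hgb
    _ = C₀ * (2 * π) ^ 3 * I * (4 : ℝ) ^ n := hbint

end L1

end Literature.MathematicalPhysics.QuantumLattice

end
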